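import Mathlib
import Literature.MathematicalPhysics.QuantumFieldTheory.Luscher2010.TrivializingMaps
import Summits.Ventures.LatticeQCDFlow.TrivializingMaps.TruncationDefect
import Summits.Ventures.LatticeQCDFlow.TrivializingMaps.GaugeCovariance
import Summits.Ventures.LatticeQCDFlow.TrivializingMaps.ZeroModes
import Summits.Ventures.LatticeQCDFlow.TrivializingMaps.LinkPolynomials
import Summits.Ventures.LatticeQCDFlow.TrivializingMaps.BasisIndependence
import HarnessLib

/-!
# Gradient control by the Laplacian on link-polynomial spaces (`‖∂u‖_∞ ≤ K ‖Δu‖_∞`)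

HONEST FRAMING: exact (Metropolis-corrected) sampling algorithms for lattice gauge theory; figures of merit are
autocorrelation/cost numbers at stated couplings and volumes; no continuum-physics claim.

Lüscher, CMP 293 (2010) 899, §4.2–4.4: on `SU(n)^E` the link Laplacian `Δ` is a non-negative operator whose
zero modes are the constants (Lüscher §4.2); on the finite-dimensional `Δ`-stable spaces of link polynomials
(`LinkPolynomials.polyL m`, Lüscher §4.4 "Δ maps polynomials to polynomials") it is therefore invertible modulo
constants with a bounded inverse. This file proves the quantitative form used by the volume law: on a FIXED
lattice there is ONE constant `K = K(d, L, n, m)` with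
`|∂_{e,Y} u(ιU)| ≤ K · sup_{U'} |Δ_B u(ιU')|` for all `u ∈ polyL m`, all links `e`, all unit `Y ∈ 𝔰𝔲(n)`,
all bases `B` and all `U ∈ SU(n)^E` (`gradient_control`). Proof: restriction to the compact group `SU(n)^E`
gives linear maps `Δ̂_B, ∂̂_{e,Y} : polyL m → C(SU(n)^E, ℝ)` (sup norm); `ker Δ̂_B ≤ ker ∂̂_{e,Y}` by the
zero-mode theorem (`ZeroModes.apply_coeConfig_eq_of_linkLap_eq_const`); hence `∂̂ = S ∘ Δ̂` for a linear `S`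
on the finite-dimensional range of `Δ̂`, automatically bounded (`LinearMap.toContinuousLinearMap`);
uniformity in `Y` by expansion in a fixed basis with coefficients bounded on the unit ball (compactness),
in `e` by finiteness, in `B` by basis independence of `Δ` (`BasisIndependence.linkLap_suBasis_eq`).
Volume-uniformity is obtained in `ExtensiveDefect` by transport to a reference lattice (`LinkTransport`).
Reference: M. Lüscher, CMP 293 (2010) 899 [Luscher2010Trivializing, arXiv:0907.5491], §4.2 (zero modes,
spectral gap), §4.4.
-/

namespace Summit.Ventures.LatticeQCDFlow.TrivializingMaps

open Literature.MathematicalPhysics.QuantumFieldTheory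
open Literature.MathematicalPhysics.QuantumFieldTheory.Luscher2010
open scoped Matrix Matrix.Norms.Frobenius ContDiff

noncomputable section

variable {d L n : ℕ} [NeZero L]

/-- Restriction of a continuous ambient functional to `SU(n)^E`, as a bundled continuous map on the compact
configuration space. [folklore] -/
def restrictCM (f : AmbConfig d L n → ℝ) (hf : Continuous f) :
    C(GaugeConfig d L (Matrix.specialUnitaryGroup (Fin n) ℂ), ℝ) :=
  ⟨fun U => f (WilsonFlow.coeConfig U), hf.comp WilsonFlow.continuous_coeConfig⟩

omit [NeZero L] in
/-- Unfolding `restrictCM`. [folklore] -/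
@[simp] theorem restrictCM_apply (f : AmbConfig d L n → ℝ) (hf : Continuous f)
    (U : GaugeConfig d L (Matrix.specialUnitaryGroup (Fin n) ℂ)) :
    restrictCM f hf U = f (WilsonFlow.coeConfig U) := rfl

/-- `Δ̂_B : polyL m → C(SU(n)^E, ℝ)`, `u ↦ (Δ_B u)|_{SU(n)^E}`. [cite: Luscher2010Trivializing, §4.2 eq. (4.6)] -/
def lapCM (B : SuBasis n) (m : ℕ) :
    polyL d L n m →ₗ[ℝ] C(GaugeConfig d L (Matrix.specialUnitaryGroup (Fin n) ℂ), ℝ) where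
  toFun u := restrictCM (linkLap B (u : AmbConfig d L n → ℝ))
    (contDiff_of_mem_polyL (linkLap_mem_polyL B u.2)).continuous
  map_add' u v := by
    ext U
    show linkLap B (fun W' => (u : AmbConfig d L n → ℝ) W' + (v : AmbConfig d L n → ℝ) W')
        (WilsonFlow.coeConfig U) =
      linkLap B (u : AmbConfig d L n → ℝ) (WilsonFlow.coeConfig U) +
        linkLap B (v : AmbConfig d L n → ℝ) (WilsonFlow.coeConfig U)
    exact linkLap_add_of_contDiff B (contDiff_of_mem_polyL u.2) (contDiff_of_mem_polyL v.2) _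
  map_smul' c u := by
    ext U
    show linkLap B (fun W' => c * (u : AmbConfig d L n → ℝ) W') (WilsonFlow.coeConfig U) =
      c * linkLap B (u : AmbConfig d L n → ℝ) (WilsonFlow.coeConfig U)
    exact linkLap_const_mul' B c _ _

/-- Unfolding `lapCM`. [folklore] -/
@[simp] theorem lapCM_apply (B : SuBasis n) (m : ℕ) (u : polyL d L n m)
    (U : GaugeConfig d L (Matrix.specialUnitaryGroup (Fin n) ℂ)) :
    lapCM B m u U = linkLap B (u : AmbConfig d L n → ℝ) (WilsonFlow.coeConfig U) := rfl

/-- `∂̂_{e,Y} : polyL m → C(SU(n)^E, ℝ)`, `u ↦ (∂_{e,Y} u)|_{SU(n)^E}`.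
[cite: Luscher2010Trivializing, App. A eq. (A.3)] -/
def derivCM (e : Edge d L) (Y : Matrix (Fin n) (Fin n) ℂ) (m : ℕ) :
    polyL d L n m →ₗ[ℝ] C(GaugeConfig d L (Matrix.specialUnitaryGroup (Fin n) ℂ), ℝ) where
  toFun u := restrictCM (linkDeriv e Y (u : AmbConfig d L n → ℝ))
    (contDiff_linkDeriv (contDiff_of_mem_polyL u.2) e Y).continuous
  map_add' u v := by
    ext U
    show linkDeriv e Y (fun W' => (u : AmbConfig d L n → ℝ) W' + (v : AmbConfig d L n → ℝ) W')
        (WilsonFlow.coeConfig U) =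
      linkDeriv e Y (u : AmbConfig d L n → ℝ) (WilsonFlow.coeConfig U) +
        linkDeriv e Y (v : AmbConfig d L n → ℝ) (WilsonFlow.coeConfig U)
    exact linkDeriv_add_of_differentiableAt e Y
      ((contDiff_of_mem_polyL u.2).differentiable (by simp) _)
      ((contDiff_of_mem_polyL v.2).differentiable (by simp) _)
  map_smul' c u := by
    ext U
    show linkDeriv e Y (fun W' => c * (u : AmbConfig d L n → ℝ) W') (WilsonFlow.coeConfig U) =
      c * linkDeriv e Y (u : AmbConfig d L n → ℝ) (WilsonFlow.coeConfig U)
    exact linkDeriv_const_mul' e Y c _ _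

/-- Unfolding `derivCM`. [folklore] -/
@[simp] theorem derivCM_apply (e : Edge d L) (Y : Matrix (Fin n) (Fin n) ℂ) (m : ℕ) (u : polyL d L n m)
    (U : GaugeConfig d L (Matrix.specialUnitaryGroup (Fin n) ℂ)) :
    derivCM e Y m u U = linkDeriv e Y (u : AmbConfig d L n → ℝ) (WilsonFlow.coeConfig U) := rfl

/-- **Zero modes**: `Δ̂_B u = 0 ⇒ ∂̂_{e,Y} u = 0` for `Y ∈ 𝔰𝔲(n)` (a functional with vanishing Laplacian on
`SU(n)^E` is constant there, hence has vanishing link gradients there).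
[cite: Luscher2010Trivializing, §4.2 (zero modes of Δ are the constants)] -/
theorem ker_lapCM_le_ker_derivCM (B : SuBasis n) (m : ℕ) (e : Edge d L) {Y : Matrix (Fin n) (Fin n) ℂ}
    (hY : Y ∈ suAlgebra n) :
    LinearMap.ker (lapCM (d := d) (L := L) B m) ≤ LinearMap.ker (derivCM e Y m) := by
  intro u hu
  rw [LinearMap.mem_ker] at hu ⊢
  have h0 : ∀ U : GaugeConfig d L (Matrix.specialUnitaryGroup (Fin n) ℂ),
      linkLap B (u : AmbConfig d L n → ℝ) (WilsonFlow.coeConfig U) = 0 := fun U => by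
    have h := ContinuousMap.congr_fun hu U
    exact h
  obtain ⟨-, hc⟩ := apply_coeConfig_eq_of_linkLap_eq_const B (contDiff_of_mem_polyL u.2) h0
  ext U
  show linkDeriv e Y (u : AmbConfig d L n → ℝ) (WilsonFlow.coeConfig U) = 0
  rw [linkDeriv_coeConfig_congr
    (ψ := fun _ => (u : AmbConfig d L n → ℝ) (WilsonFlow.coeConfig fun _ => 1)) hc e hY U]
  unfold linkDeriv
  exact deriv_const _ _

/-- **Factorisation `∂̂_{e,Y} = S ∘ Δ̂_B` with `S` bounded**: `‖∂̂_{e,Y} u‖_∞ ≤ K ‖Δ̂_B u‖_∞` on `polyL m`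
(finite-dimensional range of `Δ̂_B`; every linear map on it is bounded).
[cite: Luscher2010Trivializing, §4.2 (spectral gap of Δ), §4.4] -/
theorem exists_derivCM_le (B : SuBasis n) (m : ℕ) (e : Edge d L) {Y : Matrix (Fin n) (Fin n) ℂ}
    (hY : Y ∈ suAlgebra n) :
    ∃ K : ℝ, 0 ≤ K ∧ ∀ u : polyL d L n m, ‖derivCM e Y m u‖ ≤ K * ‖lapCM B m u‖ := by
  set Δ := lapCM (d := d) (L := L) B m with hΔdef
  set D := derivCM (d := d) (L := L) e Y m with hDdef
  let S : LinearMap.range Δ →ₗ[ℝ] C(GaugeConfig d L (Matrix.specialUnitaryGroup (Fin n) ℂ), ℝ) :=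
    (LinearMap.ker Δ).liftQ D (ker_lapCM_le_ker_derivCM B m e hY) ∘ₗ Δ.quotKerEquivRange.symm.toLinearMap
  -- `E`, `F` are named explicitly so that the sup-norm instances are synthesized before unification
  -- (the compact-open topology of `C(SU(n)^E, ℝ)` is only definitionally the norm topology).
  obtain ⟨C, hC, hle⟩ := ContinuousLinearMap.bound (𝕜 := ℝ) (𝕜₂ := ℝ) (E := LinearMap.range Δ)
    (F := C(GaugeConfig d L (Matrix.specialUnitaryGroup (Fin n) ℂ), ℝ)) (LinearMap.toContinuousLinearMap S)
  refine ⟨C, hC.le, fun u => ?_⟩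
  have h1 : Δ.quotKerEquivRange.symm ⟨Δ u, LinearMap.mem_range_self Δ u⟩ = Submodule.Quotient.mk u := by
    rw [LinearEquiv.symm_apply_eq]
    apply Subtype.ext
    simp
  have hS : S ⟨Δ u, LinearMap.mem_range_self Δ u⟩ = D u := by
    simp only [S, LinearMap.coe_comp, Function.comp_apply, LinearEquiv.coe_toLinearMap, h1,
      Submodule.liftQ_apply]
  calc ‖D u‖ = ‖LinearMap.toContinuousLinearMap S ⟨Δ u, LinearMap.mem_range_self Δ u⟩‖ := by
        rw [LinearMap.coe_toContinuousLinearMap', hS]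
    _ ≤ C * ‖(⟨Δ u, LinearMap.mem_range_self Δ u⟩ : LinearMap.range Δ)‖ := hle _
    _ = C * ‖Δ u‖ := rfl

omit [NeZero L] in
/-- The coordinates `Y ↦ Y^a = -2 Re tr(T_a Y)` are bounded on the unit ball (continuity + compactness).
[cite: Luscher2010Trivializing, App. A.3 eq. (A.10)] -/
theorem exists_coord_bound (B : SuBasis n) (a : B.ι) :
    ∃ D : ℝ, 0 ≤ D ∧ ∀ Y : Matrix (Fin n) (Fin n) ℂ, ‖Y‖ ≤ 1 → |B.coord a Y| ≤ D := by
  haveI : FiniteDimensional ℝ (Matrix (Fin n) (Fin n) ℂ) :=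
    inferInstanceAs (Module.Finite ℝ (Fin n → Fin n → ℂ))
  haveI : ProperSpace (Matrix (Fin n) (Fin n) ℂ) := FiniteDimensional.proper ℝ _
  have hc : Continuous fun Y : Matrix (Fin n) (Fin n) ℂ => B.coord a Y := by
    unfold SuBasis.coord
    exact continuous_const.mul (Complex.continuous_re.comp
      ((WilsonFlow.contDiff_trace (n := n) (m := 0)).continuous.comp (continuous_const.mul continuous_id)))
  obtain ⟨D, hD⟩ := (isCompact_closedBall (0 : Matrix (Fin n) (Fin n) ℂ) 1).exists_bound_of_continuousOn
    hc.continuousOn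
  refine ⟨max D 0, le_max_right _ _, fun Y hY => ?_⟩
  have h := hD Y (by simpa using hY)
  rw [Real.norm_eq_abs] at h
  exact h.trans (le_max_left _ _)

/-- **Gradient control by the Laplacian.** On a fixed lattice and degree there is ONE constant `K` with
`|∂_{e,Y} u(ιU)| ≤ K · M` whenever `u ∈ polyL m` and `|Δ_B u| ≤ M` on `SU(n)^E` — for every basis `B`,
link `e`, unit direction `Y ∈ 𝔰𝔲(n)` and `U ∈ SU(n)^E`.
[cite: Luscher2010Trivializing, §4.2 (Δ ≥ 0, zero modes = constants, gap), §4.4] -/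
theorem gradient_control (d L n m : ℕ) [NeZero L] :
    ∃ K : ℝ, 0 ≤ K ∧ ∀ (B : SuBasis n) (u : AmbConfig d L n → ℝ), u ∈ polyL d L n m → ∀ M : ℝ, 0 ≤ M →
      (∀ U : GaugeConfig d L (Matrix.specialUnitaryGroup (Fin n) ℂ),
        |linkLap B u (WilsonFlow.coeConfig U)| ≤ M) →
      ∀ (e : Edge d L) (Y : Matrix (Fin n) (Fin n) ℂ), Y ∈ suAlgebra n → ‖Y‖ ≤ 1 →
      ∀ U : GaugeConfig d L (Matrix.specialUnitaryGroup (Fin n) ℂ),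
        |linkDeriv e Y u (WilsonFlow.coeConfig U)| ≤ K * M := by
  by_cases hB : Nonempty (SuBasis n)
  swap
  · exact ⟨0, le_rfl, fun B => absurd ⟨B⟩ hB⟩
  obtain ⟨B₀⟩ := hB
  choose K hK0 hK using
    fun (e : Edge d L) (a : B₀.ι) => exists_derivCM_le (d := d) (L := L) B₀ m e (B₀.mem a)
  choose D hD0 hD using fun a : B₀.ι => exists_coord_bound B₀ a
  refine ⟨∑ e, ∑ a, D a * K e a,
    Finset.sum_nonneg fun e _ => Finset.sum_nonneg fun a _ => mul_nonneg (hD0 a) (hK0 e a), ?_⟩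
  intro B u hu M hM hΔ e Y hY hY1 U
  have hΔ0 : ‖lapCM B₀ m ⟨u, hu⟩‖ ≤ M := by
    refine (ContinuousMap.norm_le _ hM).2 fun U' => ?_
    rw [lapCM_apply, Real.norm_eq_abs]
    show |linkLap B₀ u (WilsonFlow.coeConfig U')| ≤ M
    rw [linkLap_suBasis_eq B₀ B (contDiff_of_mem_polyL hu)]
    exact hΔ U'
  have hdir : ∀ a, |linkDeriv e (B₀.T a) u (WilsonFlow.coeConfig U)| ≤ K e a * M := fun a => by
    have h1 : |linkDeriv e (B₀.T a) u (WilsonFlow.coeConfig U)| ≤ ‖derivCM e (B₀.T a) m ⟨u, hu⟩‖ := by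
      have h := ContinuousMap.norm_coe_le_norm (derivCM e (B₀.T a) m ⟨u, hu⟩) U
      rwa [derivCM_apply, Real.norm_eq_abs] at h
    calc _ ≤ _ := h1
      _ ≤ K e a * ‖lapCM B₀ m ⟨u, hu⟩‖ := hK e a ⟨u, hu⟩
      _ ≤ K e a * M := mul_le_mul_of_nonneg_left hΔ0 (hK0 e a)
  have hexp : linkDeriv e Y u (WilsonFlow.coeConfig U) =
      ∑ a, B₀.coord a Y * linkDeriv e (B₀.T a) u (WilsonFlow.coeConfig U) := by
    conv_lhs => rw [← sum_coord_smul_eq B₀ hY]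
    exact linkDeriv_sum_smul ((contDiff_of_mem_polyL hu).differentiable (by simp) _) e _ _
  rw [hexp]
  calc |∑ a, B₀.coord a Y * linkDeriv e (B₀.T a) u (WilsonFlow.coeConfig U)|
      ≤ ∑ a, |B₀.coord a Y * linkDeriv e (B₀.T a) u (WilsonFlow.coeConfig U)| :=
        Finset.abs_sum_le_sum_abs _ _
    _ ≤ ∑ a, D a * K e a * M := Finset.sum_le_sum fun a _ => by
        rw [abs_mul]
        calc |B₀.coord a Y| * |linkDeriv e (B₀.T a) u (WilsonFlow.coeConfig U)|
            ≤ D a * (K e a * M) := mul_le_mul (hD a Y hY1) (hdir a) (abs_nonneg _) (hD0 a)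
          _ = D a * K e a * M := by ring
    _ = (∑ a, D a * K e a) * M := by rw [Finset.sum_mul]
    _ ≤ (∑ e', ∑ a, D a * K e' a) * M := by
        refine mul_le_mul_of_nonneg_right ?_ hM
        exact Finset.single_le_sum (f := fun e' => ∑ a, D a * K e' a)
          (fun e' _ => Finset.sum_nonneg fun a _ => mul_nonneg (hD0 a) (hK0 e' a)) (Finset.mem_univ e)

end

end Summit.Ventures.LatticeQCDFlow.TrivializingMaps
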